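import Mathlib
import Summits.KontsevichZagierPeriods.Zeta5Search.ThirdOrderNorms
import Summits.KontsevichZagierPeriods.Zeta5Search.PadicFourthOrder
import Summits.KontsevichZagierPeriods.Zeta5Search.PhiHatFourthOrder
import HarnessLib

/-!
# ζ(5) search — the FOURTH-ORDER conjugation of the class units and class invariants (gen-2 g14 Lemma R, truncated)

Cell `pub-zeta5` (HONEST FRAMING: systematic search; no irrationality claim unless certified), gen-2 seat generation 15
(REPORT-gen2-g15 §3; REPORT-gen2-g14 §2 "Lemma R (exact reflection law) … consequences").  `ThirdOrderNorms.lean` §Conj one order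
further: for a level class `x < p` with top level `L` (`x + Lp ≤ b₀ < x + Lp + p`) and conjugate `x̄ = conjClass b p x = b₀ − (x + Lp)`,
* `phi3Expl_reflect` — exact: `φ₃(b₀ − q) = −φ₃(q)` (`φ₃` is ODD under the reflection, like `φ`; `φ₂`, `c` are even);
* `gHat_conj_fourth` — **`ĝ_x̄ ≡ (−1)^{E_x+1} ĝ_x (1 − Lpφ_x + L²p²c_x − L³p³c₃,x) (mod p⁴)`** (`gHat_conj` ∘ `padicNorm_gHat_sub_fourth_le`);
* `phiHat_conj_third` — **`φ_x̄ ≡ −(φ_x + Lpφ₂,x + L²p²φ₃,x) (mod p³)`**;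
* `phi2Hat_conj_second` — **`φ₂,x̄ ≡ φ₂,x + 2Lpφ₃,x (mod p²)`**;
* `phi3Expl_conj`, `cubicExpl_conj` — `φ₃,x̄ ≡ −φ₃,x`, **`c₃,x̄ ≡ −c₃,x (mod p)`**, `c₃ = (φ³ − 3φφ₂ + 2φ₃)/6`.
These are the Taylor coefficients, to the fourth order, of g14's reflection law `ĝ_x̄ Ĝ_x̄(η) = (−1)^{E+1} ĝ_x Ĝ_x(L − η)`; they are what
the fourth-order ORBIT LEMMA (REPORT-gen2-g14 §2, Lemma O) consumes.  `p`-adic norms of rational numbers; nothing here concerns irrationality.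
-/

noncomputable section

open Finset

namespace Summit.KontsevichZagierPeriods.Zeta5Search.SecondOrder

open Summit.KontsevichZagierPeriods.Zeta5Search.CasoratianValuation (InPolytope)
open Summit.KontsevichZagierPeriods.Zeta5Search.ClusterValuation
open Summit.KontsevichZagierPeriods.Zeta5Search.PadicSeries
open Summit.KontsevichZagierPeriods.Zeta5Search.CellA (padicNorm_pow_eq padicNorm_p gHat_conj)
open Summit.KontsevichZagierPeriods.Zeta5Search.LevelClass (level_mem)

variable {p : ℕ} [hp : Fact p.Prime]

/-! ### `φ₃` is odd under the reflection `q ↦ b₀ − q` (exact) -/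

omit hp in
/-- **`φ₃(b₀ − q) = −φ₃(q)`** (exact). -/
theorem phi3Expl_reflect (b : ℕ → ℤ) (h0 : 0 ≤ b 0) {q : ℕ} (hq : q ≤ (b 0).toNat) :
    phi3Expl b p ((b 0).toNat - q) = -phi3Expl b p q := by
  set N := (b 0).toNat with hN
  have hb0 : ((b 0 : ℤ) : ℚ) = (N : ℚ) := by rw [hN]; exact_mod_cast (Int.toNat_of_nonneg h0).symm
  have hcen : CentreIn b p (N - q) ↔ CentreIn b p q := centreIn_reflect b h0 hq
  set F : ℕ → Finset ℕ := fun r => (range (N + 1)).filter (fun s => s % p ≠ r % p) with hF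
  have hmemF : ∀ {r s : ℕ}, s ∈ F r ↔ s ≤ N ∧ ¬ (p : ℤ) ∣ (s : ℤ) - r := by
    intro r s
    rw [hF]; simp only [mem_filter, mem_range, Nat.lt_succ_iff]
    have : (p : ℤ) ∣ (s : ℤ) - r ↔ s % p = r % p := by
      rw [dvd_sub_comm]; exact (Nat.modEq_iff_dvd).symm
    rw [this]
  have hsum : ∀ (f : ℕ → ℚ), ∑ s ∈ F (N - q), f s = ∑ s ∈ F q, f (N - s) := by
    intro f
    refine (sum_nbij' (fun s => N - s) (fun s => N - s) (fun s hs => ?_) (fun s hs => ?_) (fun s hs => ?_)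
      (fun s hs => ?_) (fun s hs => rfl)).symm
    · obtain ⟨hsN, hnd⟩ := hmemF.1 hs
      refine hmemF.2 ⟨by omega, fun h => hnd ?_⟩
      have e : (s : ℤ) - q = -((((N - s : ℕ) : ℤ)) - ((N - q : ℕ) : ℤ)) := by omega
      rw [e]; exact h.neg_right
    · obtain ⟨hsN, hnd⟩ := hmemF.1 hs
      refine hmemF.2 ⟨by omega, fun h => hnd ?_⟩
      have e : (s : ℤ) - ((N - q : ℕ) : ℤ) = -((((N - s : ℕ) : ℤ)) - q) := by omega
      rw [e]; exact h.neg_right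
    · have := (hmemF.1 hs).1; omega
    · have := (hmemF.1 hs).1; omega
  have hdiff : ∀ s ∈ F q, (((N - s : ℕ) : ℚ) - ((N - q : ℕ) : ℚ)) = -((s : ℚ) - q) := by
    intro s hs
    have hsN := (hmemF.1 hs).1
    push_cast [Nat.cast_sub hsN, Nat.cast_sub hq]; ring
  have hcq : ((b 0 : ℤ) : ℚ) / 2 - ((N - q : ℕ) : ℚ) = -(((b 0 : ℤ) : ℚ) / 2 - q) := by
    rw [hb0]; push_cast [Nat.cast_sub hq]; ring
  have hodd3 : Odd 3 := by decide
  unfold phi3Expl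
  rw [show (range ((b 0).toNat + 1)).filter (fun s => s % p ≠ (N - q) % p) = F (N - q) from rfl,
    show (range ((b 0).toNat + 1)).filter (fun s => s % p ≠ q % p) = F q from rfl, hsum, neg_add, ← sum_neg_distrib]
  congr 1
  · refine sum_congr rfl fun s hs => ?_
    rw [ClusterValuation.netExp_reflect b h0 (hmemF.1 hs).1, hdiff s hs, hodd3.neg_pow, div_neg]
  · rw [hcq]
    simp only [hcen]
    split_ifs
    · rw [hodd3.neg_pow, div_neg]
    · rw [neg_zero]

/-! ### The conjugate class to fourth order -/

section Conj

variable (b : ℕ → ℤ) (hb : InPolytope b) (hp5 : 5 ≤ p)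
  {x L : ℕ} (hx : x < p) (hL : x + L * p ≤ (b 0).toNat) (hL' : (b 0).toNat < x + L * p + p) (hc : ¬ CentreIn b p x)
include hb hp5 hx hL hL' hc

/-- **Conjugate unit to fourth order** (either parity of the exponent):
`‖ĝ_x̄ − (−1)^{E_x+1}·ĝ_x(1 − Lpφ_x + L²p²c_x − L³p³c₃,x)‖ ≤ p⁻⁴` (`x̄ = conjClass b p x`). -/
theorem gHat_conj_fourth :
    padicNorm p (gHat b p (conjClass b p x) - (-1 : ℚ) ^ (classExp b p x + 1) * (gHat b p x *
      (1 - (L : ℚ) * p * phiHat b p x + ((L : ℚ) * p) ^ 2 * curvHat b p x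
        - ((L : ℚ) * p) ^ 3 * ((phiHat b p x ^ 3 - 3 * phiHat b p x * phi2Hat b p x + 2 * phi3Expl b p x) / 6))))
      ≤ (p : ℚ) ^ (-(4 : ℤ)) := by
  have hq := level_mem b hx hL hL' le_rfl
  have hconj : conjClass b p x = (b 0).toNat - (x + L * p) := CellKit.conjClass_eq_level b hL hL'
  have hG2 := gHat_conj b p x (x + L * p) hb hp.out hp5 hx hc hq
  have hS := padicNorm_gHat_sub_fourth_le b hp5 hx hq
  rw [level_div hx] at hS
  have hsign : padicNorm p ((-1 : ℚ) ^ (classExp b p x + 1)) = 1 := by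
    rcases Int.even_or_odd (classExp b p x + 1) with h | h
    · rw [h.neg_one_zpow, padicNorm.one]
    · rw [h.neg_one_zpow, padicNorm.neg, padicNorm.one]
  rw [hconj, hG2, ← mul_sub, padicNorm.mul, hsign, one_mul]
  exact hS

omit hc in
/-- **Conjugate `φ` to third order**: `‖φ_x̄ + (φ_x + Lpφ₂,x + L²p²φ₃,x)‖ ≤ p⁻³`. -/
theorem phiHat_conj_third :
    padicNorm p (phiHat b p (conjClass b p x)
      + (phiHat b p x + (L : ℚ) * p * phi2Hat b p x + ((L : ℚ) * p) ^ 2 * phi3Expl b p x)) ≤ (p : ℚ) ^ (-(3 : ℤ)) := by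
  have h0 : 0 ≤ b 0 := hb.1.1
  have hq := level_mem b hx hL hL' le_rfl
  have hconj : conjClass b p x = (b 0).toNat - (x + L * p) := CellKit.conjClass_eq_level b hL hL'
  have hrefl := (phiHat_reflect (p := p) b h0 (q := x + L * p) hL).1
  have hS := padicNorm_phiHat_sub_third_le b (by omega) hx hq
  rw [level_div hx] at hS
  have e : phiHat b p (conjClass b p x) + (phiHat b p x + (L : ℚ) * p * phi2Hat b p x + ((L : ℚ) * p) ^ 2 * phi3Expl b p x) =
      -(phiHat b p (x + L * p) - (phiHat b p x + (L : ℚ) * p * phi2Hat b p x + ((L : ℚ) * p) ^ 2 * phi3Expl b p x)) := by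
    rw [hconj, hrefl]; ring
  rw [e, padicNorm.neg]
  exact hS

omit hc in
/-- **Conjugate `φ₂` to second order**: `‖φ₂,x̄ − (φ₂,x + 2Lpφ₃,x)‖ ≤ p⁻²`. -/
theorem phi2Hat_conj_second :
    padicNorm p (phi2Hat b p (conjClass b p x) - (phi2Hat b p x + 2 * ((L : ℚ) * p) * phi3Expl b p x))
      ≤ (p : ℚ) ^ (-(2 : ℤ)) := by
  have h0 : 0 ≤ b 0 := hb.1.1
  have hq := level_mem b hx hL hL' le_rfl
  have hconj : conjClass b p x = (b 0).toNat - (x + L * p) := CellKit.conjClass_eq_level b hL hL'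
  have hrefl := (phiHat_reflect (p := p) b h0 (q := x + L * p) hL).2
  have hS := padicNorm_phi2Hat_sub_second_le b (by omega) hx hq
  rw [level_div hx] at hS
  rw [hconj, hrefl]
  exact hS

omit hc in
/-- **Conjugate `φ₃`**: `‖φ₃,x̄ + φ₃,x‖ ≤ p⁻¹`. -/
theorem phi3Expl_conj : padicNorm p (phi3Expl b p (conjClass b p x) + phi3Expl b p x) ≤ (p : ℚ) ^ (-(1 : ℤ)) := by
  have h0 : 0 ≤ b 0 := hb.1.1
  have hq := level_mem b hx hL hL' le_rfl
  have hconj : conjClass b p x = (b 0).toNat - (x + L * p) := CellKit.conjClass_eq_level b hL hL'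
  rw [hconj, phi3Expl_reflect (p := p) b h0 hL, neg_add_eq_sub, ← padicNorm.neg, neg_sub]
  exact padicNorm_phi3Expl_sub_le b (by omega) hx hq

omit hc in
/-- **Conjugate cubic coefficient**: `‖c₃,x̄ + c₃,x‖ ≤ p⁻¹`, `c₃,y = (φ_y³ − 3φ_yφ₂,y + 2φ₃,y)/6` (`c₃` is odd under conjugation). -/
theorem cubicExpl_conj :
    padicNorm p ((phiHat b p (conjClass b p x) ^ 3 - 3 * phiHat b p (conjClass b p x) * phi2Hat b p (conjClass b p x)
        + 2 * phi3Expl b p (conjClass b p x)) / 6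
      + (phiHat b p x ^ 3 - 3 * phiHat b p x * phi2Hat b p x + 2 * phi3Expl b p x) / 6) ≤ (p : ℚ) ^ (-(1 : ℤ)) := by
  have h0 : 0 ≤ b 0 := hb.1.1
  have hq := level_mem b hx hL hL' le_rfl
  have hconj : conjClass b p x = (b 0).toNat - (x + L * p) := CellKit.conjClass_eq_level b hL hL'
  obtain ⟨h1, h2⟩ := phiHat_reflect (p := p) b h0 (q := x + L * p) hL
  have h3 := phi3Expl_reflect (p := p) b h0 (q := x + L * p) hL
  have hS := padicNorm_cubicExpl_sub_le b hp5 hx hq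
  have e : (phiHat b p (conjClass b p x) ^ 3 - 3 * phiHat b p (conjClass b p x) * phi2Hat b p (conjClass b p x)
        + 2 * phi3Expl b p (conjClass b p x)) / 6
      + (phiHat b p x ^ 3 - 3 * phiHat b p x * phi2Hat b p x + 2 * phi3Expl b p x) / 6
      = -((phiHat b p (x + L * p) ^ 3 - 3 * phiHat b p (x + L * p) * phi2Hat b p (x + L * p)
            + 2 * phi3Expl b p (x + L * p)) / 6
          - (phiHat b p x ^ 3 - 3 * phiHat b p x * phi2Hat b p x + 2 * phi3Expl b p x) / 6) := by
    rw [hconj, h1, h2, h3]; ring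
  rw [e, padicNorm.neg]
  exact hS

end Conj

end Summit.KontsevichZagierPeriods.Zeta5Search.SecondOrder

end
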